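import Summits.QuantumFields.GaugeBoot.TensorPowerSymmetric
import Literature.MathematicalPhysics.QuantumLattice.RepLieAlgebraUnitary
import HarnessLib

/-!
# The first fundamental theorem in tensor form: invariants of `SU(N)` on `V^{⊗κ} ⊗ V̄^{⊗κ}` are spanned by the slot permutations (gauge-boot, FFT 3/7)

HONEST FRAMING (cell `pub-gaugeboot`, page 1 of every file): the venture produces certified bounds
on lattice expectations at stated coupling, gauge group, dimension and torus size; NOT a mass gap,
NOT a continuum limit, NOT a string tension; NOT Yang–Mills-summit-bearing (barriers
`FixedCouplingUltralocality`, `PerturbativeInvisibility`). Pure linear algebra; no number is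
certified. Third brick of the lane's first fundamental theorem for lattice gauge invariants.

## Content

* ★★ `Representation.mem_span_range_of_commute_commutant` — THE DOUBLE COMMUTANT THEOREM for a
  finite group `G` acting linearly on a finite-dimensional space over a field in which `|G| ≠ 0`:
  an operator commuting with every `G`-intertwiner is a linear combination of the `ρ g`
  (Maschke — Mathlib's `IsSemisimpleModule k[G]` instance — and Mathlib's Jacobson density
  theorem `jacobson_density`). [cite: GoodmanWallachGTM255, Thm. 4.1.13]
* `permRep` — the slot-permutation representation of `Equiv.Perm κ` on `(κ → n) → 𝕜` (matrices
  `permMat σ`); `mem_span_permMat_of_commute_commutant` (matrix form of the double commutant).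
* `hasDerivAt_kronPow_exp_apply` — `d/dt|₀ ((e^{tH})^{⊗κ})_{xy} = (slotSum H)_{xy}`;
  ★ `commute_slotSum_of_forall_commute_kronPow_exp` — an operator commuting with the tensor powers
  of a one-parameter group commutes with the slot sum of its generator;
  ★ `commute_slotSum_of_forall_specialUnitary` — commuting with `s^{⊗κ}` for all `s ∈ SU(n)`
  gives commuting with `slotSum X` for EVERY complex matrix `X` (`𝔰𝔲(n) ⊕ i𝔰𝔲(n) ⊕ ℂ·1 = M_n(ℂ)`,
  Weyl's unitarian trick at the Lie-algebra level; `n` nonempty).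
* ★★★ `mem_span_permMat_of_forall_specialUnitary` — TENSOR FFT: a matrix on words `κ → n`
  commuting with `s^{⊗κ}` for every `s ∈ SU(n)` is a linear combination of the slot permutation
  operators `P_σ` (hence the same for `U(n)`, `mem_span_permMat_of_forall_unitary`). Chain:
  `SU(n)` ⇒ all slot sums (derivative) ⇒ all tensor powers (Newton, FFT 2/7) ⇒ the commutant of
  the `P_σ` (polarization, FFT 2/7) ⇒ span of the `P_σ` (double commutant).

References: H. Weyl, *The Classical Groups* (1939) IV; R. Goodman, N. Wallach, GTM 255 (2009)
§4.2.4 Thm. 4.2.10; W. Fulton, J. Harris, GTM 129 Lemma 6.22 ff. Not in Mathlib.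
-/

noncomputable section

namespace Summit.QuantumFields.GaugeBoot

/-! ## The double commutant theorem for finite groups -/

section DoubleCommutant

variable {k G V : Type*} [Field k] [Group G] [Finite G] [NeZero (Nat.card G : k)]
  [AddCommGroup V] [Module k V] [FiniteDimensional k V]

/-- ★★ **Double commutant theorem for finite groups** (von Neumann–Schur): over a field in which
`|G|` is invertible, an operator on a finite-dimensional representation space commuting with every
`G`-intertwiner is a linear combination of the operators `ρ g`. Proof: Maschke makes `V` a
semisimple `k[G]`-module, the hypothesis makes `T` linear over `End_{k[G]} V`, and Jacobson density
gives `r ∈ k[G]` acting as `T` on a basis. [cite: GoodmanWallachGTM255, Thm. 4.1.13] -/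
theorem Representation.mem_span_range_of_commute_commutant (ρ : Representation k G V)
    {T : Module.End k V}
    (hT : ∀ B : Module.End k V, (∀ g, B ∘ₗ ρ g = ρ g ∘ₗ B) → B ∘ₗ T = T ∘ₗ B) :
    T ∈ Submodule.span k (Set.range fun g : G => (ρ g : Module.End k V)) := by
  classical
  -- `T` is linear over the commutant `End_{k[G]} V`
  have hlin : ∀ (B : ρ.asModule →ₗ[MonoidAlgebra k G] ρ.asModule) (m : ρ.asModule),
      T (B m) = B (T m) := by
    intro B m
    have hB : ∀ g, (B.restrictScalars k : Module.End k V) ∘ₗ ρ g = ρ g ∘ₗ (B.restrictScalars k) := by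
      intro g
      ext v
      change B (ρ g v) = ρ g (B v)
      have h1 : B (ρ.asAlgebraHom (MonoidAlgebra.of k G g) v) =
          ρ.asAlgebraHom (MonoidAlgebra.of k G g) (B v) := B.map_smul (MonoidAlgebra.of k G g) v
      have e : ∀ w : V, ρ.asAlgebraHom (MonoidAlgebra.of k G g) w = ρ g w := fun w => by
        rw [Representation.asAlgebraHom_of]
      rwa [e, e] at h1
    exact (LinearMap.congr_fun (hT _ hB) m).symm
  let f : Module.End (Module.End (MonoidAlgebra k G) ρ.asModule) ρ.asModule :=
    { toFun := fun m => T m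
      map_add' := fun a b => T.map_add a b
      map_smul' := fun B m => hlin B m }
  let b := Module.finBasis k V
  obtain ⟨r, hr⟩ := jacobson_density f (Finset.univ.image fun i => (b i : ρ.asModule))
  -- `T` agrees with `ρ.asAlgebraHom r` on the basis, hence everywhere
  have hTr : T = ρ.asAlgebraHom r := by
    refine b.ext fun i => ?_
    have h := hr (b i) (Finset.mem_image.2 ⟨i, Finset.mem_univ _, rfl⟩)
    exact h
  rw [hTr, Representation.asAlgebraHom_def, MonoidAlgebra.lift_apply]
  refine Submodule.sum_mem _ fun g _ => Submodule.smul_mem _ _ (Submodule.subset_span ⟨g, rfl⟩)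

end DoubleCommutant

namespace TensorFFT

open Matrix Finset NormedSpace
open Literature.MathematicalPhysics.QuantumLattice (mem_oneParamGenerators_specialUnitaryGroup)

/-! ## The slot-permutation representation and the matrix form of the double commutant -/

section PermRep

variable {κ n : Type*} [Fintype κ] [DecidableEq κ] [Fintype n] [DecidableEq n]
  {𝕜 : Type*} [Field 𝕜] [CharZero 𝕜]

omit [CharZero 𝕜] in
/-- **The slot-permutation representation** of `Equiv.Perm κ` on `(κ → n) → 𝕜`, by the matrices
`permMat σ`. [folklore] -/
def permRep : Representation 𝕜 (Equiv.Perm κ) ((κ → n) → 𝕜) where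
  toFun σ := Matrix.toLin' (permMat σ)
  map_one' := by rw [permMat_one, Matrix.toLin'_one]; rfl
  map_mul' σ τ := by rw [permMat_mul, Matrix.toLin'_mul]; rfl

omit [CharZero 𝕜] in
/-- `permRep σ = toLin' (permMat σ)`. -/
@[simp] theorem permRep_apply (σ : Equiv.Perm κ) :
    (permRep σ : Module.End 𝕜 ((κ → n) → 𝕜)) = Matrix.toLin' (permMat σ) := rfl

/-- ★ **Matrix form of the double commutant for the slot permutations**: a matrix on words
commuting with every matrix that commutes with all `P_σ` is a linear combination of the `P_σ`
(characteristic zero, so `|S_κ|` is invertible). -/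
theorem mem_span_permMat_of_commute_commutant {T : Matrix (κ → n) (κ → n) 𝕜}
    (hT : ∀ B : Matrix (κ → n) (κ → n) 𝕜, (∀ σ : Equiv.Perm κ, Commute (permMat σ) B) → Commute B T) :
    T ∈ Submodule.span 𝕜 (Set.range (permMat : Equiv.Perm κ → Matrix (κ → n) (κ → n) 𝕜)) := by
  haveI : NeZero (Nat.card (Equiv.Perm κ) : 𝕜) := ⟨by exact_mod_cast Nat.card_pos.ne'⟩
  have h := Representation.mem_span_range_of_commute_commutant (permRep (κ := κ) (n := n) (𝕜 := 𝕜))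
    (T := Matrix.toLin' T) (fun B hB => by
      have hB' : ∀ σ : Equiv.Perm κ, Commute (permMat σ) (LinearMap.toMatrix' B) := by
        intro σ
        have h1 := hB σ
        rw [permRep_apply] at h1
        have h2 : Matrix.toLin' (LinearMap.toMatrix' B * permMat σ) =
            Matrix.toLin' (permMat σ * LinearMap.toMatrix' B) := by
          rw [Matrix.toLin'_mul, Matrix.toLin'_mul, Matrix.toLin'_toMatrix', h1]
        exact (Matrix.toLin'.injective h2).symm
      have h3 := (hT _ hB').eq
      have h4 : Matrix.toLin' (LinearMap.toMatrix' B * T) = Matrix.toLin' (T * LinearMap.toMatrix' B) :=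
        congrArg _ h3
      rwa [Matrix.toLin'_mul, Matrix.toLin'_mul, Matrix.toLin'_toMatrix'] at h4)
  obtain ⟨c, hc⟩ := (Submodule.mem_span_range_iff_exists_fun 𝕜).1 h
  refine (Submodule.mem_span_range_iff_exists_fun 𝕜).2 ⟨c, Matrix.toLin'.injective ?_⟩
  rw [← hc, map_sum]
  simp only [map_smul, permRep_apply]

end PermRep

/-! ## One-parameter groups: from tensor powers to slot sums -/

section Deriv

open scoped Matrix.Norms.Frobenius

variable {κ n : Type*} [Fintype κ] [DecidableEq κ] [Fintype n] [DecidableEq n]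

omit [Fintype κ] [DecidableEq κ] in
/-- Entries of `t ↦ e^{tH}` have derivative `H_{ab}` at `t = 0`. [folklore] -/
theorem hasDerivAt_exp_smul_apply (H : Matrix n n ℂ) (a b : n) :
    HasDerivAt (fun t : ℝ => (exp (t • H) : Matrix n n ℂ) a b) (H a b) 0 := by
  have hexp : HasDerivAt (fun t : ℝ => exp (t • H)) (H * exp ((0 : ℝ) • H)) 0 :=
    hasDerivAt_exp_smul_const' H 0
  let L : Matrix n n ℂ →L[ℝ] ℂ :=
    LinearMap.toContinuousLinearMap ((Matrix.entryLinearMap ℂ ℂ a b).restrictScalars ℝ)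
  have h := (L.hasFDerivAt).comp_hasDerivAt (0 : ℝ) hexp
  have h' : HasDerivAt (fun t : ℝ => (exp (t • H) : Matrix n n ℂ) a b) (L (H * exp ((0 : ℝ) • H))) 0 := h
  have e : L (H * exp ((0 : ℝ) • H)) = H a b := by
    rw [zero_smul, exp_zero, mul_one]; rfl
  exact h'.congr_deriv e

/-- ★ **The derivative of the tensor power of a one-parameter group is the slot sum of the
generator**: `d/dt|₀ ((e^{tH})^{⊗κ})_{xy} = (slotSum H)_{xy}`. [folklore] -/
theorem hasDerivAt_kronPow_exp_apply (H : Matrix n n ℂ) (x y : κ → n) :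
    HasDerivAt (fun t : ℝ => (kronPow (exp (t • H)) : Matrix (κ → n) (κ → n) ℂ) x y)
      ((slotSum H : Matrix (κ → n) (κ → n) ℂ) x y) 0 := by
  have h := HasDerivAt.finsetProd (u := univ)
    (f := fun k (t : ℝ) => (exp (t • H) : Matrix n n ℂ) (x k) (y k)) (f' := fun k => H (x k) (y k))
    (x := 0) (fun k _ => hasDerivAt_exp_smul_apply H (x k) (y k))
  have e1 : (∏ k ∈ univ, fun t : ℝ => (exp (t • H) : Matrix n n ℂ) (x k) (y k)) =
      fun t : ℝ => (kronPow (exp (t • H)) : Matrix (κ → n) (κ → n) ℂ) x y := by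
    funext t; rw [Finset.prod_apply, kronPow_apply]
  have e2 : ∑ k ∈ univ, (∏ j ∈ univ.erase k, (exp ((0 : ℝ) • H) : Matrix n n ℂ) (x j) (y j)) • H (x k) (y k)
      = (slotSum H : Matrix (κ → n) (κ → n) ℂ) x y := by
    rw [slotSum_def, Matrix.sum_apply]
    refine sum_congr rfl fun k _ => ?_
    rw [slotOp_def, kron_apply, prod_update_apply, smul_eq_mul, mul_comm, zero_smul, exp_zero]
    rfl
  rw [e1, e2] at h
  exact h

/-- ★ **An operator commuting with the tensor powers `(e^{tH})^{⊗κ}` of a one-parameter group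
commutes with the slot sum of its generator** (differentiate `e^{tH ⊗κ} T = T e^{tH ⊗κ}` at
`t = 0`, entry by entry). [folklore] -/
theorem commute_slotSum_of_forall_commute_kronPow_exp {T : Matrix (κ → n) (κ → n) ℂ} (H : Matrix n n ℂ)
    (hT : ∀ t : ℝ, Commute (kronPow (exp (t • H)) : Matrix (κ → n) (κ → n) ℂ) T) :
    Commute (slotSum H : Matrix (κ → n) (κ → n) ℂ) T := by
  refine Matrix.ext fun x y => ?_
  -- both sides of `(Δ(H) T)_{xy} = (T Δ(H))_{xy}` are derivatives at 0 of the same function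
  have hL : HasDerivAt (fun t : ℝ => ((kronPow (exp (t • H)) : Matrix (κ → n) (κ → n) ℂ) * T) x y)
      (((slotSum H : Matrix (κ → n) (κ → n) ℂ) * T) x y) 0 := by
    simp only [Matrix.mul_apply]
    exact HasDerivAt.fun_sum fun z _ => (hasDerivAt_kronPow_exp_apply H x z).mul_const (T z y)
  have hR : HasDerivAt (fun t : ℝ => (T * (kronPow (exp (t • H)) : Matrix (κ → n) (κ → n) ℂ)) x y)
      ((T * (slotSum H : Matrix (κ → n) (κ → n) ℂ)) x y) 0 := by
    simp only [Matrix.mul_apply]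
    exact HasDerivAt.fun_sum fun z _ => (hasDerivAt_kronPow_exp_apply H z y).const_mul (T x z)
  have e : (fun t : ℝ => ((kronPow (exp (t • H)) : Matrix (κ → n) (κ → n) ℂ) * T) x y) =
      fun t : ℝ => (T * (kronPow (exp (t • H)) : Matrix (κ → n) (κ → n) ℂ)) x y := by
    funext t; rw [(hT t).eq]
  rw [e] at hL
  exact hL.unique hR

variable [Nonempty n]

/-- ★ **Unitarian trick at the Lie-algebra level**: a matrix on words commuting with `s^{⊗κ}` for
every `s ∈ SU(n)` commutes with the slot sum `slotSum X` of EVERY complex matrix `X`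
(`X = A + iB + (tr X / n)·1` with `A, B` traceless skew-Hermitian; `slotSum 1` is central). -/
theorem commute_slotSum_of_forall_specialUnitary {T : Matrix (κ → n) (κ → n) ℂ}
    (hT : ∀ s : Matrix n n ℂ, s ∈ Matrix.specialUnitaryGroup n ℂ →
      Commute (kronPow s : Matrix (κ → n) (κ → n) ℂ) T)
    (X : Matrix n n ℂ) : Commute (slotSum X : Matrix (κ → n) (κ → n) ℂ) T := by
  -- traceless skew-Hermitian generators
  have hgen : ∀ H : Matrix n n ℂ, star H = -H → H.trace = 0 →
      Commute (slotSum H : Matrix (κ → n) (κ → n) ℂ) T := fun H hH h0 =>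
    commute_slotSum_of_forall_commute_kronPow_exp H fun t =>
      hT _ (mem_oneParamGenerators_specialUnitaryGroup hH h0 t)
  -- decomposition of `X`
  set c : ℂ := X.trace / Fintype.card n with hc
  set X₀ : Matrix n n ℂ := X - c • 1 with hX₀
  have hN : (Fintype.card n : ℂ) ≠ 0 := by exact_mod_cast Fintype.card_ne_zero
  have htr₀ : X₀.trace = 0 := by
    rw [hX₀, trace_sub, trace_smul, trace_one, hc, smul_eq_mul, div_mul_cancel₀ _ hN, sub_self]
  set A : Matrix n n ℂ := (2 : ℂ)⁻¹ • (X₀ - X₀ᴴ) with hA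
  set B : Matrix n n ℂ := (-(Complex.I / 2)) • (X₀ + X₀ᴴ) with hB
  have hA1 : star A = -A := by
    rw [hA, star_eq_conjTranspose, conjTranspose_smul, conjTranspose_sub, conjTranspose_conjTranspose,
      ← smul_neg, neg_sub]
    congr 1
    rw [Complex.star_def, map_inv₀, map_ofNat]
  have hB1 : star B = -B := by
    rw [hB, star_eq_conjTranspose, conjTranspose_smul, conjTranspose_add, conjTranspose_conjTranspose,
      add_comm, ← neg_smul]
    congr 1
    simp only [Complex.star_def, map_neg, map_div₀, Complex.conj_I, map_ofNat, neg_div, neg_neg]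
  have htrA : A.trace = 0 := by
    rw [hA, trace_smul, trace_sub, trace_conjTranspose, htr₀, star_zero, sub_zero, smul_zero]
  have htrB : B.trace = 0 := by
    rw [hB, trace_smul, trace_add, trace_conjTranspose, htr₀, star_zero, add_zero, smul_zero]
  have hX : X = A + Complex.I • B + c • 1 := by
    have e1 : A + Complex.I • B = X₀ := by
      have hI : Complex.I * -(Complex.I / 2) = (2 : ℂ)⁻¹ := by
        rw [mul_neg, mul_div_assoc', Complex.I_mul_I, neg_div, neg_neg, one_div]
      rw [hA, hB, smul_smul, hI, ← smul_add]
      have e2 : X₀ - X₀ᴴ + (X₀ + X₀ᴴ) = (2 : ℂ) • X₀ := by rw [two_smul]; abel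
      rw [e2, smul_smul, inv_mul_cancel₀ two_ne_zero, one_smul]
    rw [e1, hX₀, sub_add_cancel]
  clear_value A B
  rw [hX, slotSum_add, slotSum_add, slotSum_smul Complex.I B, slotSum_smul c (1 : Matrix n n ℂ),
    slotSum_one]
  refine Commute.add_left (Commute.add_left (hgen A hA1 htrA) ((hgen B hB1 htrB).smul_left _)) ?_
  exact ((Commute.one_left T).smul_left _).smul_left _

/-! ## The first fundamental theorem, tensor form -/

/-- ★★★ **FIRST FUNDAMENTAL THEOREM (tensor form, `SU(n)`)**: a matrix on words `κ → n` that
commutes with `s^{⊗κ}` for every `s ∈ SU(n)` is a linear combination of the slot permutation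
operators `P_σ`, `σ ∈ S_κ` — the `SU(n)`-invariants of `V^{⊗κ} ⊗ V̄^{⊗κ}` (`V = ℂⁿ`) are spanned
by the permutation contractions. [cite: GoodmanWallachGTM255, Thm. 4.2.10] -/
theorem mem_span_permMat_of_forall_specialUnitary {T : Matrix (κ → n) (κ → n) ℂ}
    (hT : ∀ s : Matrix n n ℂ, s ∈ Matrix.specialUnitaryGroup n ℂ →
      Commute (kronPow s : Matrix (κ → n) (κ → n) ℂ) T) :
    T ∈ Submodule.span ℂ (Set.range (permMat : Equiv.Perm κ → Matrix (κ → n) (κ → n) ℂ)) := by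
  refine mem_span_permMat_of_commute_commutant fun B hB => ?_
  -- `B` commutes with every `P_σ`, so is a combination of tensor powers, which commute with `T`
  have hBmem := mem_span_kronPow_of_forall_commute_permMat hB
  have hslot := commute_slotSum_of_forall_specialUnitary hT
  have hpow : ∀ X : Matrix n n ℂ, Commute (kronPow X : Matrix (κ → n) (κ → n) ℂ) T :=
    commute_kronPow_of_forall_commute_slotSum hslot
  refine Submodule.span_induction (p := fun B _ => Commute B T) ?_ ?_ ?_ ?_ hBmem
  · rintro _ ⟨X, rfl⟩; exact hpow X
  · exact Commute.zero_left T
  · intro a b _ _ ha hb; exact ha.add_left hb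
  · intro c a _ ha; exact ha.smul_left c

/-- ★★★ **FIRST FUNDAMENTAL THEOREM (tensor form, `U(n)`)**: the same with `U(n)` (a weaker
hypothesis would do: `SU(n) ⊆ U(n)`). [cite: GoodmanWallachGTM255, Thm. 4.2.10] -/
theorem mem_span_permMat_of_forall_unitary {T : Matrix (κ → n) (κ → n) ℂ}
    (hT : ∀ u : Matrix n n ℂ, u ∈ Matrix.unitaryGroup n ℂ →
      Commute (kronPow u : Matrix (κ → n) (κ → n) ℂ) T) :
    T ∈ Submodule.span ℂ (Set.range (permMat : Equiv.Perm κ → Matrix (κ → n) (κ → n) ℂ)) :=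
  mem_span_permMat_of_forall_specialUnitary fun s hs => hT s (Matrix.mem_specialUnitaryGroup_iff.1 hs).1

omit [Nonempty n] in
/-- Converse (trivial half): every combination of slot permutations commutes with all tensor
powers. -/
theorem commute_kronPow_of_mem_span_permMat {T : Matrix (κ → n) (κ → n) ℂ}
    (hT : T ∈ Submodule.span ℂ (Set.range (permMat : Equiv.Perm κ → Matrix (κ → n) (κ → n) ℂ)))
    (X : Matrix n n ℂ) : Commute (kronPow X : Matrix (κ → n) (κ → n) ℂ) T := by
  refine Submodule.span_induction (p := fun B _ => Commute (kronPow X : Matrix (κ → n) (κ → n) ℂ) B)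
    ?_ ?_ ?_ ?_ hT
  · rintro _ ⟨σ, rfl⟩; exact (commute_permMat_kronPow σ X).symm
  · exact Commute.zero_right _
  · intro a b _ _ ha hb; exact ha.add_right hb
  · intro c a _ ha; exact ha.smul_right c

end Deriv

end TensorFFT

end Summit.QuantumFields.GaugeBoot

end
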